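import Mathlib.Analysis.SpecialFunctions.Log.Deriv
import Mathlib.Analysis.Calculus.Deriv.MeanValue
import HarnessLib

/-!
# The `C¹` branch of Hamilton's improving pinching function `(1 + K / max{ln x, Q}) x`
(topic `Geometry/Riemannian`)

Part of the decomposition of `Literature.Geometry.Riemannian.hamilton_chenZhu_pinching`
(`PinchingEstimates.lean`), towards the ODE parts of Hamilton 1997, Thm. 2.1 (p. 13) and
Thm. 2.3 (p. 17): "the inequality `y ≤ f(x)`, `f(x) = (1 + K/ln x) x` for `x ≥ e²`,
`f(x) = (1 + K/2) x` for `x ≤ e²` … is preserved" (p. 14; with `2` replaced by `Q` in Thm. 2.3).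
Hamilton's `f` has a corner at `x = e^Q`; below `e^Q` the inequality is implied by the previous
pinching estimates (p. 14: "we can take `K` so large that `1 + K/2 ≥ Λ` and then the inequality
… is preserved by our previous pinching estimate. So we only need to check when `x ≥ e²`").
To run the smooth minimum principle of `HamiltonODEMinBarrier.lean` we therefore replace `f` by
its `C¹` branch through the corner: PROVED here, elementary calculus of

* `logBranch Q x` — `ln x` for `x ≥ e^Q`, continued below `e^Q` by its tangent line
  `Q - 1 + x/e^Q` (so `0 < logBranch Q x ≤ max{ln x, Q}` for `Q ≥ 1`, `x > 0`);
* `phiQ Q x = x / logBranch Q x` (increasing, `C¹` on `(0, ∞)`), and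
  `impFn K Q x = x + K · phiQ Q x`, which is `(1 + K/ln x) x` for `x ≥ e^Q`, dominates Hamilton's
  `f` everywhere and exceeds `(1 + K/Q) x` strictly below `e^Q`;
* derivatives (`hasDerivAt_logBranch`, `hasDerivAt_phiQ`, `hasDerivAt_impFn`), continuity of the
  derivatives on `(0, ∞)`, `impFn' ≥ 1`, strict monotonicity, and the closed forms above `e^Q`
  used in Hamilton's boundary computation (p. 15: `x f'(x)/f(x)` with `f = (1 + K/ln x) x`).

## References

* R. S. Hamilton, *Four-manifolds with positive isotropic curvature*, Comm. Anal. Geom. 5 (1997)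
  1–92, §2.2, Thm. 2.1 (pp. 13–14) and Thm. 2.3 (p. 17). [Hamilton1997]
-/

noncomputable section

open Set Real Filter
open scoped Topology

namespace Literature.Geometry.Riemannian

namespace HamiltonODE

/-! ### The `C¹` continuation of `ln` below `e^Q` -/

/-- `ln x` for `x ≥ e^Q`, its tangent line `Q - 1 + x / e^Q` at `e^Q` for `x ≤ e^Q`. [folklore] -/
def logBranch (Q x : ℝ) : ℝ := if exp Q ≤ x then log x else Q - 1 + x / exp Q

/-- The derivative of `logBranch Q`: `1/x` above `e^Q`, `1/e^Q` below. [folklore] -/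
def logBranchDeriv (Q x : ℝ) : ℝ := if exp Q ≤ x then x⁻¹ else (exp Q)⁻¹

variable {K Q x : ℝ}

/-- Above `e^Q` the branch is `ln`. [folklore] -/
theorem logBranch_of_le (h : exp Q ≤ x) : logBranch Q x = log x := by simp [logBranch, h]

/-- Below `e^Q` the branch is the tangent line. [folklore] -/
theorem logBranch_of_lt (h : x < exp Q) : logBranch Q x = Q - 1 + x / exp Q := by
  simp [logBranch, not_le.2 h]

/-- On `x ≤ e^Q` the branch is the tangent line (the two formulas agree at `e^Q`). [folklore] -/
theorem logBranch_of_le' (h : x ≤ exp Q) : logBranch Q x = Q - 1 + x / exp Q := by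
  rcases h.lt_or_eq with h | h
  · exact logBranch_of_lt h
  · subst h
    rw [logBranch_of_le le_rfl, log_exp, div_self (exp_pos Q).ne']
    ring

/-- Above `e^Q`: `Q ≤ logBranch Q x`. [folklore] -/
theorem le_logBranch (h : exp Q ≤ x) : Q ≤ logBranch Q x := by
  rw [logBranch_of_le h]
  have := log_le_log (exp_pos Q) h
  rwa [log_exp] at this

/-- Below `e^Q`: `logBranch Q x < Q`. [folklore] -/
theorem logBranch_lt (h : x < exp Q) : logBranch Q x < Q := by
  rw [logBranch_of_lt h]
  have : x / exp Q < 1 := (div_lt_one (exp_pos Q)).2 h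
  linarith

/-- `logBranch Q x ≤ Q` for `x ≤ e^Q`. [folklore] -/
theorem logBranch_le (h : x ≤ exp Q) : logBranch Q x ≤ Q := by
  rw [logBranch_of_le' h]
  have : x / exp Q ≤ 1 := (div_le_one (exp_pos Q)).2 h
  linarith

/-- Positivity: `0 < logBranch Q x` for `Q ≥ 1`, `x > 0`. [folklore] -/
theorem logBranch_pos (hQ : 1 ≤ Q) (hx : 0 < x) : 0 < logBranch Q x := by
  rcases le_or_gt (exp Q) x with h | h
  · linarith [le_logBranch h]
  · rw [logBranch_of_lt h]
    have : 0 < x / exp Q := div_pos hx (exp_pos Q)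
    linarith

/-- `logBranch Q x ≤ max{ln x, Q}` (`x > 0`). [folklore] -/
theorem logBranch_le_max (x : ℝ) : logBranch Q x ≤ max (log x) Q := by
  rcases le_or_gt (exp Q) x with h | h
  · rw [logBranch_of_le h]; exact le_max_left _ _
  · exact (logBranch_lt h).le.trans (le_max_right _ _)

/-- **The branch is `C¹`**: `HasDerivAt (logBranch Q) (logBranchDeriv Q x) x` for `x > 0` (the
tangent line matches value and slope of `ln` at `e^Q`). [folklore] -/
theorem hasDerivAt_logBranch (hx : 0 < x) : HasDerivAt (logBranch Q) (logBranchDeriv Q x) x := by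
  have haff : ∀ y, HasDerivAt (fun y ↦ Q - 1 + y / exp Q) (exp Q)⁻¹ y := fun y ↦ by
    have h := ((hasDerivAt_id y).div_const (exp Q)).const_add (Q - 1)
    simpa [one_div] using h
  rcases lt_trichotomy x (exp Q) with h | h | h
  · -- below the corner: eventually the tangent line
    have hev : logBranch Q =ᶠ[𝓝 x] fun y ↦ Q - 1 + y / exp Q := by
      filter_upwards [Iio_mem_nhds h] with y hy using logBranch_of_lt hy
    rw [show logBranchDeriv Q x = (exp Q)⁻¹ by simp [logBranchDeriv, not_le.2 h]]
    exact (haff x).congr_of_eventuallyEq hev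
  · -- at the corner: glue the one-sided derivatives
    subst h
    have hval : logBranchDeriv Q (exp Q) = (exp Q)⁻¹ := by simp [logBranchDeriv]
    rw [hval]
    have hl : HasDerivWithinAt (logBranch Q) (exp Q)⁻¹ (Iic (exp Q)) (exp Q) :=
      (haff (exp Q)).hasDerivWithinAt.congr (fun y hy ↦ logBranch_of_le' hy) (logBranch_of_le' le_rfl)
    have hr : HasDerivWithinAt (logBranch Q) (exp Q)⁻¹ (Ici (exp Q)) (exp Q) :=
      (hasDerivAt_log (exp_pos Q).ne').hasDerivWithinAt.congr (fun y hy ↦ logBranch_of_le hy)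
        (logBranch_of_le le_rfl)
    have := hl.union hr
    rwa [Iic_union_Ici, hasDerivWithinAt_univ] at this
  · -- above the corner: eventually `ln`
    have hev : logBranch Q =ᶠ[𝓝 x] log := by
      filter_upwards [Ioi_mem_nhds h] with y hy using logBranch_of_le hy.le
    rw [show logBranchDeriv Q x = x⁻¹ by simp [logBranchDeriv, h.le]]
    exact (hasDerivAt_log hx.ne').congr_of_eventuallyEq hev

/-- Closed form of the derivative: `min{1/x, 1/e^Q}` (`x > 0`). [folklore] -/
theorem logBranchDeriv_eq_min (hx : 0 < x) : logBranchDeriv Q x = min x⁻¹ (exp Q)⁻¹ := by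
  rcases le_or_gt (exp Q) x with h | h
  · rw [show logBranchDeriv Q x = x⁻¹ by simp [logBranchDeriv, h], eq_comm, min_eq_left_iff]
    exact inv_anti₀ (exp_pos Q) h
  · rw [show logBranchDeriv Q x = (exp Q)⁻¹ by simp [logBranchDeriv, not_le.2 h], eq_comm,
      min_eq_right_iff]
    exact (inv_lt_inv₀ (exp_pos Q) hx |>.2 h).le

/-- The branch is continuous on `(0, ∞)`. [folklore] -/
theorem continuousOn_logBranch (Q : ℝ) : ContinuousOn (logBranch Q) (Ioi 0) :=
  fun _ hx ↦ (hasDerivAt_logBranch hx).continuousAt.continuousWithinAt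

/-- Its derivative is continuous on `(0, ∞)`. [folklore] -/
theorem continuousOn_logBranchDeriv (Q : ℝ) : ContinuousOn (logBranchDeriv Q) (Ioi 0) := by
  have hinv : ContinuousOn (fun x : ℝ ↦ x⁻¹) (Ioi 0) :=
    continuousOn_inv₀.mono fun x hx ↦ (ne_of_gt (mem_Ioi.1 hx) : x ≠ (0 : ℝ))
  have h : ContinuousOn (fun x : ℝ ↦ min x⁻¹ (exp Q)⁻¹) (Ioi 0) := hinv.inf continuousOn_const
  exact h.congr fun x hx ↦ logBranchDeriv_eq_min hx

/-- `x · logBranch'(x) ≤ logBranch(x)` for `Q ≥ 1`, `x > 0` (so `x ↦ x / logBranch Q x` is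
increasing). [folklore] -/
theorem mul_logBranchDeriv_le (hQ : 1 ≤ Q) (hx : 0 < x) :
    x * logBranchDeriv Q x ≤ logBranch Q x := by
  rcases le_or_gt (exp Q) x with h | h
  · rw [show logBranchDeriv Q x = x⁻¹ by simp [logBranchDeriv, h], mul_inv_cancel₀ hx.ne']
    linarith [le_logBranch h]
  · rw [show logBranchDeriv Q x = (exp Q)⁻¹ by simp [logBranchDeriv, not_le.2 h], logBranch_of_lt h,
      div_eq_mul_inv]
    linarith

/-- The derivative is positive (`x > 0`). [folklore] -/
theorem logBranchDeriv_pos (hx : 0 < x) : 0 < logBranchDeriv Q x := by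
  rw [logBranchDeriv_eq_min hx]
  exact lt_min (inv_pos.2 hx) (inv_pos.2 (exp_pos Q))

/-! ### `φ_Q(x) = x / logBranch Q x` and Hamilton's improving function -/

/-- `φ_Q(x) = x / logBranch Q x` (`= x / ln x` above `e^Q`). [folklore] -/
def phiQ (Q x : ℝ) : ℝ := x / logBranch Q x

/-- Its derivative `(h - x h') / h²`, `h = logBranch Q`. [folklore] -/
def phiQDeriv (Q x : ℝ) : ℝ :=
  (logBranch Q x - x * logBranchDeriv Q x) / logBranch Q x ^ 2

/-- **The `C¹` branch of Hamilton's improving function**: `impFn K Q x = x + K x / logBranch Q x`,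
equal to `(1 + K / ln x) x` for `x ≥ e^Q` (Hamilton 1997, p. 14, with `2` generalised to `Q` as
in Thm. 2.3). [cite: Hamilton1997, §2.2, Thm. 2.1 (proof, p. 14)] -/
def impFn (K Q x : ℝ) : ℝ := x + K * phiQ Q x

/-- Its derivative. [folklore] -/
def impFnDeriv (K Q x : ℝ) : ℝ := 1 + K * phiQDeriv Q x

/-- Derivative of `φ_Q` (`Q ≥ 1`, `x > 0`). [folklore] -/
theorem hasDerivAt_phiQ (hQ : 1 ≤ Q) (hx : 0 < x) : HasDerivAt (phiQ Q) (phiQDeriv Q x) x := by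
  have h := (hasDerivAt_id x).div (hasDerivAt_logBranch (Q := Q) hx) (logBranch_pos hQ hx).ne'
  refine h.congr_deriv ?_
  simp only [phiQDeriv, id, one_mul]

/-- `φ_Q' ≥ 0`. [folklore] -/
theorem phiQDeriv_nonneg (hQ : 1 ≤ Q) (hx : 0 < x) : 0 ≤ phiQDeriv Q x :=
  div_nonneg (by linarith [mul_logBranchDeriv_le hQ hx]) (sq_nonneg _)

/-- `φ_Q'` is continuous on `(0, ∞)`. [folklore] -/
theorem continuousOn_phiQDeriv (hQ : 1 ≤ Q) : ContinuousOn (phiQDeriv Q) (Ioi 0) := by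
  unfold phiQDeriv
  refine ((continuousOn_logBranch Q).sub (continuousOn_id.mul (continuousOn_logBranchDeriv Q))).div
    ((continuousOn_logBranch Q).pow 2) fun x hx ↦ ?_
  exact pow_ne_zero 2 (logBranch_pos hQ hx).ne'

/-- `φ_Q` is continuous on `(0, ∞)`. [folklore] -/
theorem continuousOn_phiQ (hQ : 1 ≤ Q) : ContinuousOn (phiQ Q) (Ioi 0) :=
  fun _ hx ↦ (hasDerivAt_phiQ hQ hx).continuousAt.continuousWithinAt

/-- **Derivative of the improving function.** [folklore] -/
theorem hasDerivAt_impFn (hQ : 1 ≤ Q) (hx : 0 < x) :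
    HasDerivAt (impFn K Q) (impFnDeriv K Q x) x := by
  have h := (hasDerivAt_id x).add ((hasDerivAt_phiQ hQ hx).const_mul K)
  have e : impFn K Q = fun y ↦ id y + K * phiQ Q y := by funext y; simp [impFn]
  rw [e]
  exact h

/-- `impFn' ≥ 1` for `K ≥ 0`. [folklore] -/
theorem one_le_impFnDeriv (hQ : 1 ≤ Q) (hK : 0 ≤ K) (hx : 0 < x) : 1 ≤ impFnDeriv K Q x := by
  have := mul_nonneg hK (phiQDeriv_nonneg hQ hx)
  simp only [impFnDeriv]; linarith

/-- `impFn'` is continuous on `(0, ∞)`. [folklore] -/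
theorem continuousOn_impFnDeriv (hQ : 1 ≤ Q) (K : ℝ) : ContinuousOn (impFnDeriv K Q) (Ioi 0) :=
  continuousOn_const.add (continuousOn_const.mul (continuousOn_phiQDeriv hQ))

/-- `impFn` is continuous on `(0, ∞)`. [folklore] -/
theorem continuousOn_impFn (hQ : 1 ≤ Q) (K : ℝ) : ContinuousOn (impFn K Q) (Ioi 0) :=
  fun _ hx ↦ (hasDerivAt_impFn (K := K) hQ hx).continuousAt.continuousWithinAt

/-- **`impFn` is strictly increasing on `(0, ∞)`** (`K ≥ 0`; Hamilton, p. 14: "`y` is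
increasing since `y' ≥ 1`"). [cite: Hamilton1997, §2.2, Thm. 2.1 (proof, p. 14)] -/
theorem impFn_strictMonoOn (hQ : 1 ≤ Q) (hK : 0 ≤ K) : StrictMonoOn (impFn K Q) (Ioi 0) := by
  refine strictMonoOn_of_deriv_pos (convex_Ioi 0) (continuousOn_impFn hQ K) fun x hx ↦ ?_
  rw [interior_Ioi] at hx
  rw [(hasDerivAt_impFn (K := K) hQ hx).deriv]
  linarith [one_le_impFnDeriv hQ hK hx]

/-! ### Comparison with Hamilton's `f(x) = (1 + K / max{ln x, Q}) x` -/

/-- **Hamilton's function is dominated by the branch**: `(1 + K / max{ln x, Q}) x ≤ impFn K Q x`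
for `x > 0`, `K ≥ 0`, `Q ≥ 1`. [cite: Hamilton1997, §2.2, Thm. 2.1 (proof, p. 14)] -/
theorem hamiltonFn_le_impFn (hQ : 1 ≤ Q) (hK : 0 ≤ K) (hx : 0 < x) :
    (1 + K / max (log x) Q) * x ≤ impFn K Q x := by
  have hh := logBranch_pos hQ hx
  have hle := logBranch_le_max (Q := Q) x
  have hKx : 0 ≤ K * x := mul_nonneg hK hx.le
  have key : K * x / max (log x) Q ≤ K * x / logBranch Q x := div_le_div_of_nonneg_left hKx hh hle
  have e1 : (1 + K / max (log x) Q) * x = x + K * x / max (log x) Q := by ring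
  have e2 : impFn K Q x = x + K * x / logBranch Q x := by simp only [impFn, phiQ]; ring
  rw [e1, e2]; linarith

/-- Above `e^Q` the two functions coincide. [cite: Hamilton1997, §2.2, Thm. 2.1 (proof, p. 14)] -/
theorem impFn_eq_hamiltonFn (h : exp Q ≤ x) : impFn K Q x = (1 + K / max (log x) Q) * x := by
  have hlog : Q ≤ log x := by
    have := log_le_log (exp_pos Q) h
    rwa [log_exp] at this
  rw [max_eq_left hlog]
  simp only [impFn, phiQ, logBranch_of_le h]
  ring

/-- Above `e^Q`: `impFn K Q x = (1 + K / ln x) x`. [folklore] -/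
theorem impFn_of_le (h : exp Q ≤ x) : impFn K Q x = (1 + K / log x) * x := by
  simp only [impFn, phiQ, logBranch_of_le h]; ring

/-- Below `e^Q` Hamilton's function is the linear bound `(1 + K/Q) x` (`x > 0`).
[cite: Hamilton1997, §2.2, Thm. 2.1 (proof, p. 14)] -/
theorem hamiltonFn_of_lt (hx : 0 < x) (h : x < exp Q) :
    (1 + K / max (log x) Q) * x = (1 + K / Q) * x := by
  have hlog : log x < Q := by
    have := log_lt_log hx h
    rwa [log_exp] at this
  rw [max_eq_right hlog.le]

/-- **Strictly below `e^Q` the branch strictly exceeds the linear bound** (`K > 0`, `x > 0`):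
`(1 + K/Q) x < impFn K Q x`; so a point with `impFn K Q x ≤ y ≤ (1 + K/Q) x` has `x ≥ e^Q`.
[folklore] -/
theorem linear_lt_impFn (hQ : 1 ≤ Q) (hK : 0 < K) (hx : 0 < x) (h : x < exp Q) :
    (1 + K / Q) * x < impFn K Q x := by
  have hh := logBranch_pos hQ hx
  have hlt := logBranch_lt h
  have hKx : 0 < K * x := mul_pos hK hx
  have key : K * x / Q < K * x / logBranch Q x := div_lt_div_of_pos_left hKx hh hlt
  have e1 : (1 + K / Q) * x = x + K * x / Q := by ring
  have e2 : impFn K Q x = x + K * x / logBranch Q x := by simp only [impFn, phiQ]; ring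
  rw [e1, e2]; linarith

/-- If `impFn K Q x ≤ (1 + K/Q) x` (`K > 0`, `x > 0`) then `e^Q ≤ x`. [folklore] -/
theorem exp_le_of_impFn_le (hQ : 1 ≤ Q) (hK : 0 < K) (hx : 0 < x)
    (h : impFn K Q x ≤ (1 + K / Q) * x) : exp Q ≤ x := by
  by_contra hcon
  exact absurd h (not_le.2 (linear_lt_impFn hQ hK hx (not_le.1 hcon)))

/-- Above `e^Q`: `x · impFn'(x) = (1 + K/ln x - K/(ln x)²) x` (Hamilton, p. 15: the factor
`1 + K/ln x - K/ln²x`). [cite: Hamilton1997, §2.2, Thm. 2.1 (proof, p. 15)] -/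
theorem impFnDeriv_of_le (h : exp Q ≤ x) (hx : 0 < x) :
    impFnDeriv K Q x = 1 + K / log x - K / log x ^ 2 := by
  have hd : logBranchDeriv Q x = x⁻¹ := by simp [logBranchDeriv, h]
  simp only [impFnDeriv, phiQDeriv, logBranch_of_le h, hd, mul_inv_cancel₀ hx.ne']
  rcases eq_or_ne (log x) 0 with h0 | h0
  · simp [h0]
  · field_simp
    ring

end HamiltonODE

end Literature.Geometry.Riemannian

end
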